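import Summits.BirchSwinnertonDyer.BirchSwinnertonDyer.Theorems.PrintCFramBottomClassIndexLawFiveLeCuspSeedCutReindex
import Summits.BirchSwinnertonDyer.BirchSwinnertonDyer.Theorems.PrintCFramBottomClassIndexLawFiveLeCohenCutKronecker
import Mathlib.NumberTheory.LSeries.Basic
import HarnessLib

set_option autoImplicit false

/-!
# Crux `PrintCFram.BottomClassIndexLawFiveLe` (stmt-BirchSwinnertonDyer-20372), line `eisenstein-resource-bdp-line` (registry v24):
# (E2) OF THE CUSP-CONJUNCT ASSEMBLY, PART 2 — THE UNFOLDING OF THE CUT COHEN `L`-SERIES ALONG `a = m · N · f²`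
# (cell `bsd-print-cfram`, width seat `bsd-line-cfram-p1-w5` g6; THEOREMS ONLY, `--supports` 20372; BSD is not proved by any of this)

HONEST FRAMING. Elementary; nothing modular. Ingredient (E2) of the proof plan for the cusp conjunct «`G = 0 ⟹ ι C = 0`» of the
registered stub `stub_cuspCutForm` (= `hcut` of `CuspSeed.cuspSeed_six_of_cutForm`, p688228; plan: crux notes
`Lines/eisenstein-resource-bdp-line-w5g5-cusp-seed.md` §1 «PARAMETRISATION», §5, §15), continuing `…CuspSeedCutReindex.lean`
(`CuspSeed.tsum_ite_cut_eq_tsum_prod`: the (3,0)-`m`-cut is parametrised by `a = m N f²`, `N` in the family, `f ⊥ 6m`):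

* `coprime_of_family`, `cohenH_mul_mul_sq_eq` — Cohen's formula on the cut: `H(k, m N f²) = L(1−k, χ_D) · T_k(D, f)` with
  `D = e·(−N)` a fundamental discriminant, for `e` a fundamental discriminant or `1` with `|e| = m` and the parity `(−1)^k m = −e`
  (w4 g12 `CohenCut.isFundamental_mul_neg` + `CohenEisenstein.cohenH_eq`; the class-datum-free form of w4 g12's
  `CohenCut.cohenH_cut_eq`, where `e = χ(−1)·m`);
* **`LSeries_ite_cut_cohenH_eq`** — for `s` in the domain of absolute convergence of the cut series,
  `Σ_{a ∈ CUT} H(k,a) a^{−s} = Σ_{N ∈ F} L(1−k, χ_{e·(−N)}) · (mN)^{−s} · L(𝟙_{⊥6m} T_k(e·(−N), ·), 2s)`,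
  the inner series being LEMMA B's (`CuspSeed.LSeries_ite_coprime_cohenT`, `…CuspSeedCohenTLSeries.lean`): this is `L(F_e, s)`
  (up to `m^{−s}`) as the `(d, f)` double sum of the crux notes §5, ready for the family average (w3 g13's (III)) in `N`.

[folklore] beyond Cohen's definition. References: [Cohen1975] §2; [MontgomeryVaughan2007] Thm. 9.13.
-/

-- summit-side namespace `Summit.BirchSwinnertonDyer.BirchSwinnertonDyer.…` (single-conjunct summit, D-0017 layout)
set_option linter.dupNamespace false

namespace Summit.BirchSwinnertonDyer.BirchSwinnertonDyer.Theorems.PrintCFram.CuspSeed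

open Literature.NumberTheory.ModularForms.CohenEisenstein
open scoped NumberTheorySymbols Classical

/-! ## §4 Cohen's formula along the cut -/

/-- For `N` in the family, every prime of `m` is prime to `N` (`J(−N|q) = 1` for odd `q ∣ m`; `N` odd). [folklore] -/
theorem coprime_of_family {m N : ℕ} (h4 : N % 4 = 3)
    (hJ : ∀ q : ℕ, q.Prime → q ∣ m → q ≠ 2 → J(-(N : ℤ) | q) = 1) : m.Coprime N := by
  refine Nat.Coprime.symm (Nat.coprime_of_dvd fun q hq hqN hqm ↦ ?_)
  by_cases hq2 : q = 2
  · subst hq2; omega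
  · haveI := Fact.mk hq
    have h1 := hJ q hq hqm hq2
    have h0 : J(-(N : ℤ) | q) = 0 := by
      rw [jacobiSym.eq_zero_iff]
      refine ⟨hq.ne_zero, ?_⟩
      rw [Int.neg_gcd, Int.gcd_natCast_natCast]
      exact fun h ↦ hq.one_lt.ne' (by rw [← h]; exact (Nat.gcd_eq_right hqN).symm)
    rw [h0] at h1
    exact zero_ne_one h1

/-- **Cohen's formula along the cut:** for `e` a fundamental discriminant or `1` with `|e| = m` and the parity `(−1)^k m = −e`,
`N` in the family and `f ≥ 1`: `H(k, m N f²) = L(1−k, χ_{D}) · T_k(D, f)` with `D = e·(−N)` (a fundamental discriminant: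
w4 g12 `CohenCut.isFundamental_mul_neg`; then `CohenEisenstein.cohenH_eq`). [cite: Cohen1975, §2 (definition of H(r, N))] -/
theorem cohenH_mul_mul_sq_eq {k : ℕ} {e : ℤ}
    (he : e = 1 ∨ (e % 4 = 1 ∧ Squarefree e ∧ e ≠ 1) ∨ (4 ∣ e ∧ (e / 4 % 4 = 2 ∨ e / 4 % 4 = 3) ∧ Squarefree (e / 4)))
    {m : ℕ} (hme : e.natAbs = m) (hsign : (-1 : ℤ) ^ k * m = -e) {N f : ℕ} (hN : Squarefree N) (h4 : N % 4 = 3)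
    (hJ : ∀ q : ℕ, q.Prime → q ∣ m → q ≠ 2 → J(-(N : ℤ) | q) = 1) (hf : f ≠ 0) :
    cohenH k (m * (N * f ^ 2)) = lValueDisc k (e * -(N : ℤ)) * cohenT k (e * -(N : ℤ)) f := by
  refine cohenH_eq ⟨Or.inr ?_, Nat.pos_of_ne_zero hf, ?_⟩
  · exact CohenCut.isFundamental_mul_neg he h4 hN (hme ▸ coprime_of_family h4 hJ)
  · push_cast
    rw [show (-1 : ℤ) ^ k * ((m : ℤ) * ((N : ℤ) * (f : ℤ) ^ 2)) = ((-1 : ℤ) ^ k * m) * N * (f : ℤ) ^ 2 by ring, hsign]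
    ring


/-! ## §5 The `L`-series of the cut Cohen sequence, unfolded along `a = m N f²` -/

/-- **(E2) THE UNFOLDING.** For `e` a fundamental discriminant or `1`, `m = |e| ≥ 1`, parity `(−1)^k m = −e`, and `s` in the
domain of absolute convergence of the cut series:
`Σ_{a ∈ CUT} H(k,a) a^{−s} = Σ_{N ∈ F} L(1−k, χ_{e·(−N)}) (mN)^{−s} · Σ_{f ⊥ 6m} T_k(e·(−N), f) f^{−2s}`,
where `CUT` is the (3,0)-`m`-cut of `stub_cuspCutForm` and `F` the family of squarefree `N ≡ 3 (mod 4)` (`≡ 7 (mod 8)` if `2 ∣ m`)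
with `J(−N|q) = 1` for odd primes `q ∣ m` and `3 ∤ N` (crux notes `Lines/eisenstein-resource-bdp-line-w5g5-cusp-seed.md` §1, §5:
`L(F_e, s)` as the `(d, f)` double sum; the inner series is LEMMA B's, `CuspSeed.LSeries_ite_coprime_cohenT`).
[cite: Cohen1975, §2 (definition of H(r, N))] -/
theorem LSeries_ite_cut_cohenH_eq {k : ℕ} {e : ℤ}
    (he : e = 1 ∨ (e % 4 = 1 ∧ Squarefree e ∧ e ≠ 1) ∨ (4 ∣ e ∧ (e / 4 % 4 = 2 ∨ e / 4 % 4 = 3) ∧ Squarefree (e / 4)))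
    {m : ℕ} (hme : e.natAbs = m) (hm : m ≠ 0) (hsign : (-1 : ℤ) ^ k * m = -e) {s : ℂ}
    (hsum : LSeriesSummable (fun a : ℕ ↦ if m ∣ a ∧ a / m % 4 = 3 ∧
        (∀ q : ℕ, q.Prime → q ∣ m → q ≠ 2 → J(-((a / m : ℕ) : ℤ) | q) = 1) ∧ (2 ∣ m → a / m % 8 = 7) ∧ ¬ 3 ∣ a / m
        then (cohenH k a : ℂ) else 0) s) :
    LSeries (fun a : ℕ ↦ if m ∣ a ∧ a / m % 4 = 3 ∧
        (∀ q : ℕ, q.Prime → q ∣ m → q ≠ 2 → J(-((a / m : ℕ) : ℤ) | q) = 1) ∧ (2 ∣ m → a / m % 8 = 7) ∧ ¬ 3 ∣ a / m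
        then (cohenH k a : ℂ) else 0) s =
      ∑' N : ℕ, (if Squarefree N ∧ N % 4 = 3 ∧ (2 ∣ m → N % 8 = 7) ∧
          (∀ q : ℕ, q.Prime → q ∣ m → q ≠ 2 → J(-(N : ℤ) | q) = 1) ∧ ¬ 3 ∣ N then
        (lValueDisc k (e * -(N : ℤ)) : ℂ) * ((m : ℂ) * (N : ℂ)) ^ (-s) *
          LSeries (fun f : ℕ ↦ if f.Coprime (6 * m) then (cohenT k (e * -(N : ℤ)) f : ℂ) else 0) (2 * s) else 0) := by
  classical
  -- the terms of the cut series in `ite` form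
  set g : ℕ → ℂ := fun a ↦ (cohenH k a : ℂ) / (a : ℂ) ^ s with hg
  have hterm : ∀ a : ℕ, LSeries.term (fun a : ℕ ↦ if m ∣ a ∧ a / m % 4 = 3 ∧
      (∀ q : ℕ, q.Prime → q ∣ m → q ≠ 2 → J(-((a / m : ℕ) : ℤ) | q) = 1) ∧ (2 ∣ m → a / m % 8 = 7) ∧ ¬ 3 ∣ a / m
      then (cohenH k a : ℂ) else 0) s a =
      if m ∣ a ∧ a / m % 4 = 3 ∧ (∀ q : ℕ, q.Prime → q ∣ m → q ≠ 2 → J(-((a / m : ℕ) : ℤ) | q) = 1) ∧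
        (2 ∣ m → a / m % 8 = 7) ∧ ¬ 3 ∣ a / m then g a else 0 := by
    intro a
    rcases eq_or_ne a 0 with rfl | ha
    · rw [LSeries.term_zero, if_neg]
      rintro ⟨-, h4, -⟩
      rw [Nat.zero_div] at h4
      omega
    · rw [LSeries.term_of_ne_zero ha]
      split_ifs <;> simp [hg]
  have hf0 : ∀ {f : ℕ}, f.Coprime (6 * m) → f ≠ 0 := by
    intro f hf h0
    rw [h0, Nat.coprime_zero_left] at hf
    omega
  rw [LSeries, tsum_congr hterm, tsum_ite_cut_eq_tsum_prod hm g]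
  have hsum' : Summable (fun x : ℕ × ℕ ↦ if (Squarefree x.1 ∧ x.1 % 4 = 3 ∧ (2 ∣ m → x.1 % 8 = 7) ∧
      (∀ q : ℕ, q.Prime → q ∣ m → q ≠ 2 → J(-(x.1 : ℤ) | q) = 1) ∧ ¬ 3 ∣ x.1) ∧ x.2.Coprime (6 * m)
      then g (m * (x.1 * x.2 ^ 2)) else 0) := by
    rw [← summable_ite_cut_iff_summable_prod hm g]
    refine hsum.congr fun a ↦ hterm a
  rw [hsum'.tsum_prod]
  refine tsum_congr fun N ↦ ?_
  by_cases hN : Squarefree N ∧ N % 4 = 3 ∧ (2 ∣ m → N % 8 = 7) ∧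
      (∀ q : ℕ, q.Prime → q ∣ m → q ≠ 2 → J(-(N : ℤ) | q) = 1) ∧ ¬ 3 ∣ N
  · rw [if_pos hN, LSeries, ← tsum_mul_left]
    refine tsum_congr fun f ↦ ?_
    by_cases hcop : f.Coprime (6 * m)
    · have hfne : f ≠ 0 := hf0 hcop
      have hfc : (f : ℂ) ≠ 0 := Nat.cast_ne_zero.mpr hfne
      rw [if_pos ⟨hN, hcop⟩, LSeries.term_of_ne_zero hfne, if_pos hcop, hg]
      simp only
      rw [cohenH_mul_mul_sq_eq he hme hsign hN.1 hN.2.1 hN.2.2.2.1 hfne]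
      push_cast
      have hsplit : ((m : ℂ) * ((N : ℂ) * (f : ℂ) ^ 2)) ^ s = (m : ℂ) ^ s * ((N : ℂ) ^ s * ((f : ℂ) ^ s * (f : ℂ) ^ s)) := by
        rw [show ((m : ℂ) * ((N : ℂ) * (f : ℂ) ^ 2)) = (m : ℂ) * ((N * (f * f) : ℕ) : ℂ) by push_cast; ring,
          Complex.natCast_mul_natCast_cpow, Nat.cast_mul, Complex.natCast_mul_natCast_cpow, Nat.cast_mul,
          Complex.natCast_mul_natCast_cpow]
      have hm' : (m : ℂ) ^ s ≠ 0 := by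
        rw [Ne, Complex.cpow_eq_zero_iff, not_and_or]; exact Or.inl (Nat.cast_ne_zero.mpr hm)
      have hN' : (N : ℂ) ^ s ≠ 0 := by
        rw [Ne, Complex.cpow_eq_zero_iff, not_and_or]; exact Or.inl (Nat.cast_ne_zero.mpr hN.1.ne_zero)
      have hf' : (f : ℂ) ^ s ≠ 0 := by
        rw [Ne, Complex.cpow_eq_zero_iff, not_and_or]; exact Or.inl hfc
      rw [hsplit, Complex.cpow_neg, Complex.natCast_mul_natCast_cpow, two_mul, Complex.cpow_add _ _ hfc]
      field_simp
    · rw [if_neg (fun h ↦ hcop h.2), LSeries.term_def]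
      simp [hcop]
  · rw [if_neg hN]
    simp only [hN, false_and, if_false, tsum_zero]

end Summit.BirchSwinnertonDyer.BirchSwinnertonDyer.Theorems.PrintCFram.CuspSeed
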